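import Summits.AnomalousDissipation.AnomalousDissipation.Theorems.SolenoidalFractalHomogenisationLagrangianStepCellClauseCuts
import Literature.Analysis.FluidPDE.PassiveVectorTensorSymmetry
import Literature.Analysis.FluidPDE.PassiveVectorTensorFastBlock
import Literature.Analysis.FunctionSpaces.TorusFourierCalculus
import HarnessLib

/-!
# K1L `LagrangianRenormalisationStep` (stmt-AnomalousDissipation-24912), line `onelevel`: the CORRECTOR-CONTENT clause (C) of
# the tensor cell package `CellEnergyClausesNoE`, proved with an explicit constant (helper towards `stub_cellEnergyT`)

Helper file of route `SolenoidalFractalHomogenisation` (prover-only; no named facts, no new definitions, no sorry).  Clause (C) of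
`CellEnergyClausesNoE W M hM c lo hi Λ β C ν₀ K` (landed p629134 / p613864) says: for every cell viscosity `ν < ν₀`, every `n`, every
constant tensor `𝔸` in the `ν`-scaled nested window, every slow mode `ℓ ≠ 0` with `‖ℓ‖⌈K/ν⌉ ≤ n`, unit `p ⊥ ℓ`, every `T > 0` and EVERY
weak solution `w` of the cell problem (tensor `(1/n²)•𝔸`, carrier `cellField W M hM ν _ n`) from the datum `Re e_ℓ·p`, for a.e. `t ∈ (0,T)`,
`∫‖w t‖² − lowEnergy (n/2) (w t) ≤ C·(c‖ℓ‖²/(n²ν²))·∫‖Re e_ℓ·p‖²`.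

`cell_corrector_content` proves exactly this for ALL `ν₀ > 0`, `K ≥ ν₀` and the EXPLICIT constant `C = 9k²Λ²/(π⁴ lo² c)` (`k` = number of
phases of `W`), from the Literature bricks landed for it: Bloch-sector preservation of every weak solution along the `1/n`-periodic cell
carrier (`PassiveVectorTensorSymmetry.ae_mFourierCoeff_eq_zero_off_sector`: the solution lives on `{±ℓ} + nℤ³`, so its only modes below
`n/2` are `±ℓ` and every other mode has `|k|² ≥ n²/4`), and the fast-block bound
(`PassiveVectorTensorFastBlock.ae_complement_energy_le` with `S = {ℓ, −ℓ}`, `ρ = n²/4`, `Γ = 2π‖ℓ‖√E₀`, `‖cell‖ ≤ k/(2πn)`,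
`lo' = ν lo/(λ n²)`): `‖(1 − P_{±ℓ}) w(t)‖² ≤ 9k²λ²‖ℓ‖²E₀/(π⁴ n² ν² lo²)`.  Numerics of record (F-p5g5-2, evidence on 24912): measured
`C·c ≥ 2.4·10⁻⁴`; here `C·c = 9k²Λ²/(π⁴lo²)` (crude but uniform).

§1 dictionary `modeCoeff / sectorEnergy / lowEnergy ↔ mFourierCoeff (complexify ∘ ·)`; §2 the cell carrier: sup bound WITH the `1/n`
(the tree's `norm_cell_le` drops it) and invariance under the `n`-torsion grid; §3 the sector gap; §4 the clause.  This is NOT the stub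
(`stub_cellEnergyT` also owes clause (F)), not the crux, and says nothing about anomalous dissipation.  Prover seat `lead-k1l-onelevel-p1` g0.
-/

set_option linter.dupNamespace false

noncomputable section

namespace Summit.AnomalousDissipation.AnomalousDissipation.Theorems.SolenoidalFractalHomogenisation.LagrangianStep

open Literature.Analysis Literature.Analysis.FluidPDE Literature.Analysis.FunctionSpaces
open Literature.Analysis.FluidPDE.LatticeShear
open MeasureTheory Set Filter Function UnitAddTorus
open scoped ENNReal NNReal InnerProductSpace
open Summit.AnomalousDissipation.AnomalousDissipation.Theorems.SolenoidalFractalHomogenisation.RealisedQuasiStaticCellLaw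

/-! ## §1 Dictionary -/

/-- `modeCoeff ℓ f i` is the `i`-th coordinate of the Fourier coefficient of the complexification (integrable `f`). [folklore] -/
theorem modeCoeff_eq {f : VF} (hf : Integrable f volume) (ℓ : Fin 3 → ℤ) (i : Fin 3) :
    modeCoeff ℓ f i = mFourierCoeff (FunctionSpaces.EuclideanSpace.complexify ∘ f) ℓ i := by
  rw [FunctionSpaces.Torus.mFourierCoeff_complexify_apply hf, modeCoeff, FunctionSpaces.Torus.mFourierCoeff_eq_integral_volume]
  refine integral_congr_ae (ae_of_all _ fun x => ?_)
  simp only [mFourier_neg, smul_eq_mul]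

/-- `‖latticeVec ℓ‖² = |ℓ|²` (`freqNormSq`). [folklore] -/
theorem norm_latticeVec_sq' (ℓ : Fin 3 → ℤ) : ‖Torus.latticeVec ℓ‖ ^ 2 = FunctionSpaces.Torus.freqNormSq ℓ := by
  rw [EuclideanSpace.norm_sq_eq, FunctionSpaces.Torus.freqNormSq]
  refine Finset.sum_congr rfl fun i _ => ?_
  rw [Torus.latticeVec_apply, Real.norm_eq_abs, sq_abs]

/-- `sectorEnergy ℓ f = ‖𝓕(complexify ∘ f)(ℓ)‖²` (integrable `f`). [folklore] -/
theorem sectorEnergy_eq {f : VF} (hf : Integrable f volume) (ℓ : Fin 3 → ℤ) :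
    sectorEnergy ℓ f = ‖mFourierCoeff (FunctionSpaces.EuclideanSpace.complexify ∘ f) ℓ‖ ^ 2 := by
  rw [sectorEnergy, EuclideanSpace.norm_sq_eq]
  exact Finset.sum_congr rfl fun i _ => by rw [modeCoeff_eq hf]

/-- `0 ≤ sectorEnergy`. [folklore] -/
theorem sectorEnergy_nonneg (ℓ : Fin 3 → ℤ) (f : VF) : 0 ≤ sectorEnergy ℓ f :=
  Finset.sum_nonneg fun _ _ => sq_nonneg _

/-- A coordinate of an integer vector is bounded by the norm of its lattice vector. [folklore] -/
theorem abs_coord_le_norm_latticeVec (ℓ : Fin 3 → ℤ) (j : Fin 3) : |(ℓ j : ℝ)| ≤ ‖Torus.latticeVec ℓ‖ := by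
  have h := FunctionSpaces.Torus.abs_apply_le_norm (Torus.latticeVec ℓ) j
  rwa [Torus.latticeVec_apply] at h

open Classical in
/-- The two modes `±ℓ` (`ℓ ≠ 0`, `‖ℓ‖ ≤ L`) are counted by `lowEnergy L`. [folklore] -/
theorem pair_le_lowEnergy {ℓ : Fin 3 → ℤ} (hℓ : ℓ ≠ 0) {L : ℝ} (hL : ‖Torus.latticeVec ℓ‖ ≤ L) (f : VF) :
    sectorEnergy ℓ f + sectorEnergy (-ℓ) f ≤ lowEnergy L f := by
  unfold lowEnergy
  have hneg : ‖Torus.latticeVec (-ℓ)‖ = ‖Torus.latticeVec ℓ‖ := by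
    rw [← Real.sqrt_sq (norm_nonneg _), ← Real.sqrt_sq (norm_nonneg (Torus.latticeVec ℓ)),
      norm_latticeVec_sq', norm_latticeVec_sq', FunctionSpaces.Torus.freqNormSq_neg]
  have hmem : ∀ k : Fin 3 → ℤ, ‖Torus.latticeVec k‖ ≤ L →
      k ∈ (Fintype.piFinset fun _ : Fin 3 => Finset.Icc (-⌈L⌉) ⌈L⌉).filter (fun k => ‖Torus.latticeVec k‖ ≤ L) := by
    intro k hk
    refine Finset.mem_filter.2 ⟨Fintype.mem_piFinset.2 fun i => Finset.mem_Icc.2 ?_, hk⟩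
    have h1 : |(k i : ℝ)| ≤ L := (abs_coord_le_norm_latticeVec k i).trans hk
    have h2 : |(k i : ℝ)| ≤ ⌈L⌉ := h1.trans (Int.le_ceil L)
    have h3 : |k i| ≤ ⌈L⌉ := by exact_mod_cast h2
    exact abs_le.1 h3
  have hne : ℓ ≠ -ℓ := by
    intro h
    apply hℓ
    funext i
    have hi := congrArg (fun v => v i) h
    simp only [Pi.neg_apply] at hi
    have : ℓ i = 0 := by omega
    simpa using this
  calc sectorEnergy ℓ f + sectorEnergy (-ℓ) f = ∑ k ∈ ({ℓ, -ℓ} : Finset (Fin 3 → ℤ)), sectorEnergy k f := by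
        rw [Finset.sum_pair hne]
    _ ≤ _ := Finset.sum_le_sum_of_subset_of_nonneg
        (by
          intro k hk
          rcases Finset.mem_insert.1 hk with rfl | hk
          · exact hmem _ hL
          · rw [Finset.mem_singleton.1 hk]; exact hmem _ (hneg ▸ hL))
        (fun k _ _ => sectorEnergy_nonneg k f)

/-! ## §2 The cell carrier: sup bound with the `1/n`, grid invariance -/

/-- `‖W.cell n t x‖ ≤ k/(2π n)` (`n ≥ 1`): one slot layer `sin(2π m·y + φ)/(2π|m|) ê` at a time, rescaled by `1/n`. [folklore] -/
theorem norm_cell_le_div {k : ℕ} (W : LatticeWord k) {n : ℕ} (hn : 0 < n) (t : ℝ) (x : UnitAddTorus (Fin 3)) :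
    ‖W.cell n t x‖ ≤ k / (2 * Real.pi * n) := by
  rw [LatticeWord.cell, norm_smul, Real.norm_eq_abs, abs_of_nonneg (by positivity)]
  have hn' : (0:ℝ) < n := by exact_mod_cast hn
  calc 1 / (n:ℝ) * ‖W.carrier t (n • x)‖ ≤ 1 / (n:ℝ) * (k / (2 * Real.pi)) :=
        mul_le_mul_of_nonneg_left (PermissibleCarrier.norm_carrier_nsmul_le W t n x) (by positivity)
    _ = k / (2 * Real.pi * n) := by field_simp

/-- The `n`-torsion grid points are killed by `n •`: `n • (jᵢ/n)ᵢ = 0` in `T³`. [folklore] -/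
theorem nsmul_grid_eq_zero {n : ℕ} (hn : 0 < n) (j : Fin 3 → Fin n) :
    n • (fun i => ((((j i : ℕ) : ℝ) / n : ℝ) : UnitAddCircle)) = (0 : UnitAddTorus (Fin 3)) := by
  funext i
  simp only [Pi.smul_apply, Pi.zero_apply]
  rw [← AddCircle.coe_nsmul, nsmul_eq_mul]
  have hn' : (n:ℝ) ≠ 0 := by exact_mod_cast hn.ne'
  rw [show (n:ℝ) * (((j i : ℕ) : ℝ) / n) = ((j i : ℕ) : ℝ) by field_simp]
  rw [AddCircle.coe_eq_zero_iff]
  exact ⟨(j i : ℕ), by simp⟩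

/-- The cell carrier is invariant under the `n`-torsion grid translations (it is `1/n`-periodic). [folklore] -/
theorem cell_add_grid {k : ℕ} (W : LatticeWord k) {n : ℕ} (hn : 0 < n) (j : Fin 3 → Fin n) (t : ℝ) (x : UnitAddTorus (Fin 3)) :
    W.cell n t (x + fun i => ((((j i : ℕ) : ℝ) / n : ℝ) : UnitAddCircle)) = W.cell n t x := by
  simp only [LatticeWord.cell, smul_add, nsmul_grid_eq_zero hn j, add_zero]

/-! ## §3 The sector gap -/

/-- In the symmetric Bloch sector of `ℓ` (`2|ℓᵢ| ≤ n`), every mode other than `±ℓ` has `|k|² ≥ n²/4`. [folklore] -/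
theorem freqNormSq_ge_of_sector {n : ℕ} {ℓ k' : Fin 3 → ℤ} (hℓ : ∀ i, 2 * |(ℓ i : ℝ)| ≤ n)
    (hsec : (∀ i, (n : ℤ) ∣ k' i - ℓ i) ∨ (∀ i, (n : ℤ) ∣ k' i + ℓ i)) (hk1 : k' ≠ ℓ) (hk2 : k' ≠ -ℓ) :
    (n : ℝ) ^ 2 / 4 ≤ FunctionSpaces.Torus.freqNormSq k' := by
  -- a coordinate where `k'` differs from `±ℓ` differs by a nonzero multiple of `n`
  have key : ∀ (e : Fin 3 → ℤ), (∀ i, 2 * |(e i : ℝ)| ≤ n) → (∀ i, (n:ℤ) ∣ k' i - e i) → k' ≠ e →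
      (n : ℝ) ^ 2 / 4 ≤ FunctionSpaces.Torus.freqNormSq k' := by
    intro e he hdvd hne
    obtain ⟨i, hi⟩ : ∃ i, k' i ≠ e i := by
      by_contra hc
      push Not at hc
      exact hne (funext hc)
    obtain ⟨q, hq⟩ := hdvd i
    have hq0 : q ≠ 0 := by
      rintro rfl
      apply hi
      have : k' i - e i = 0 := by simpa using hq
      omega
    have hq1 : (1:ℝ) ≤ |(q:ℝ)| := by exact_mod_cast Int.one_le_abs hq0
    have hki : (k' i : ℝ) = e i + n * q := by
      have : (k' i : ℤ) = e i + n * q := by omega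
      exact_mod_cast this
    have hbound : (n:ℝ) / 2 ≤ |(k' i : ℝ)| := by
      have h1 : |(n:ℝ) * q| ≤ |(k' i : ℝ)| + |(e i : ℝ)| := by
        rw [show (n:ℝ) * q = k' i - e i by rw [hki]; ring]
        exact abs_sub _ _
      have h2 : (n:ℝ) ≤ |(n:ℝ) * q| := by
        rw [abs_mul, abs_of_nonneg (by positivity : (0:ℝ) ≤ n)]
        nlinarith [hq1, (show (0:ℝ) ≤ n by positivity)]
      have h3 := he i
      linarith
    have hsq : (n:ℝ) ^ 2 / 4 ≤ (k' i : ℝ) ^ 2 := by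
      have : ((n:ℝ) / 2) ^ 2 ≤ |(k' i : ℝ)| ^ 2 := pow_le_pow_left₀ (by positivity) hbound 2
      rw [sq_abs] at this
      linarith
    calc (n:ℝ) ^ 2 / 4 ≤ (k' i : ℝ) ^ 2 := hsq
      _ ≤ FunctionSpaces.Torus.freqNormSq k' := by
          unfold FunctionSpaces.Torus.freqNormSq
          exact Finset.single_le_sum (f := fun j => (k' j : ℝ) ^ 2) (fun j _ => sq_nonneg _) (Finset.mem_univ i)
  rcases hsec with h | h
  · exact key ℓ hℓ h hk1
  · refine key (-ℓ) (fun i => by simpa using hℓ i) (fun i => by simpa [sub_eq_add_neg] using h i) hk2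

/-! ## §4 Clause (C) with an explicit constant -/

set_option maxHeartbeats 400000 in
/-- **Corrector content of a slow-datum cell solution (clause (C) of `CellEnergyClausesNoE`, explicit constant).**  For the design
`W.stretch M` with bookkept gain `c > 0`, window `(lo, hi, Λ, β)` with `lo > 0`, `Λ ≥ 1`, and ANY `0 < ν₀ ≤ K`: for every `ν ∈ (0, ν₀)`, `n`,
constant tensor `𝔸` with `OddSmall 𝔸 (νβ)` and `NearIso 𝔸 (ν lo/λ) (ν hi λ)` for some `λ ∈ [1, Λ]`, every `ℓ ≠ 0` with `‖ℓ‖⌈K/ν⌉ ≤ n`,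
unit `p ⊥ ℓ`, `T > 0` and every weak solution `w` of the cell problem from `Re e_ℓ·p`:
`∫‖w t‖² − lowEnergy (n/2) (w t) ≤ (9k²Λ²/(π⁴lo²c))·(c‖ℓ‖²/(n²ν²))·∫‖Re e_ℓ·p‖²` for a.e. `t ∈ (0,T)`
(sector preservation + the fast-block bound with `S = {±ℓ}`, `ρ = n²/4`, `Γ = 2π‖ℓ‖√E₀`, `‖cell‖ ≤ k/(2πn)`).
[cite: RobinsonRodrigoSadowski2016, §4.2 (4.20)] -/
theorem cell_corrector_content {k : ℕ} (W : LatticeWord k) (M : ℝ) (hM : 0 < M) {c : ℝ} (hc : 0 < c)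
    {lo hi Λ β : ℝ} (hlo : 0 < lo) (hΛ : 1 ≤ Λ) {ν₀ K : ℝ} (hν₀ : 0 < ν₀) (hK : ν₀ ≤ K) :
    ∀ ν, ∀ hν : ν ∈ Set.Ioo 0 ν₀, ∀ n : ℕ, ∀ 𝔸 : Torus.Visc4 (Fin 3),
      Torus.OddSmall 𝔸 (ν * β) → (∃ lam ∈ Set.Icc (1:ℝ) Λ, Torus.NearIso 𝔸 (ν * (lo / lam)) (ν * (hi * lam))) →
      ∀ ℓ : Fin 3 → ℤ, ℓ ≠ 0 → ‖Torus.latticeVec ℓ‖ * (⌈K / ν⌉₊ : ℝ) ≤ n →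
      ∀ p : EuclideanSpace ℝ (Fin 3), ‖p‖ = 1 → ⟪p, Torus.latticeVec ℓ⟫_ℝ = 0 →
      ∀ T > (0:ℝ), ∀ w : ℝ → VF,
        Torus.IsWeakTensorPassiveVectorOn 0 T ((1 / (n:ℝ) ^ 2) • 𝔸) (cellField W M hM ν hν.1 n) (fun x => (UnitAddTorus.mFourier ℓ x).re • p) w →
        ∀ᵐ t ∂(volume.restrict (Ioo 0 T)),
          ∫ x, ‖w t x‖ ^ 2 - lowEnergy ((n:ℝ) / 2) (w t)
            ≤ (9 * (k:ℝ) ^ 2 * Λ ^ 2 / (Real.pi ^ 4 * lo ^ 2 * c)) * (c * ‖Torus.latticeVec ℓ‖ ^ 2 / ((n:ℝ) ^ 2 * ν ^ 2)) *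
              ∫ x, ‖(UnitAddTorus.mFourier ℓ x).re • p‖ ^ 2 := by
  intro ν hν n 𝔸 _hodd hwin ℓ hℓ hband p _hp hpℓ T _hT w hw
  classical
  obtain ⟨lam, hlam, hA⟩ := hwin
  have hlam1 : 0 < lam := lt_of_lt_of_le one_pos hlam.1
  have hνpos : 0 < ν := hν.1
  -- the slow band forces `n ≥ 1` and `2|ℓᵢ| ≤ n`
  have hKν : 2 ≤ (⌈K / ν⌉₊ : ℝ) := by
    have h1 : 1 < K / ν := (one_lt_div hνpos).2 (lt_of_lt_of_le hν.2 hK)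
    have h2 : 2 ≤ ⌈K / ν⌉₊ := by
      have := Nat.lt_ceil.2 (show ((1:ℕ) : ℝ) < K / ν by exact_mod_cast h1)
      omega
    exact_mod_cast h2
  have hℓpos : 0 < ‖Torus.latticeVec ℓ‖ := norm_latticeVec_pos_of_ne_zero hℓ
  have hn1 : 1 ≤ (n:ℝ) := one_le_of_slowBand hℓ (lt_of_lt_of_le hν₀ hK) hνpos hband
  have hn : 0 < n := by exact_mod_cast (show (0:ℝ) < n by linarith)
  have hℓn : 2 * ‖Torus.latticeVec ℓ‖ ≤ n := by nlinarith
  have hℓi : ∀ i, 2 * |(ℓ i : ℝ)| ≤ n := fun i => by linarith [abs_coord_le_norm_latticeVec ℓ i]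
  have hℓL : ‖Torus.latticeVec ℓ‖ ≤ (n:ℝ) / 2 := by linarith
  -- the data of `ae_complement_energy_le`
  set w₀ : VF := fun x => (UnitAddTorus.mFourier ℓ x).re • p with hw₀_def
  have hw₀2 : MemLp w₀ 2 volume := memLp_two_of_memSobolev_one_complexify (memSobolev_one_singleMode ℓ p)
  have hdiv₀ : Torus.IsWeaklyDivFree w₀ := isWeaklyDivFree_singleMode ℓ hpℓ
  have hN : Torus.NearIso ((1 / (n:ℝ) ^ 2) • 𝔸) ((1 / (n:ℝ) ^ 2) * (ν * (lo / lam))) ((1 / (n:ℝ) ^ 2) * (ν * (hi * lam))) :=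
    hA.smul (by positivity)
  have hlo' : 0 < (1 / (n:ℝ) ^ 2) * (ν * (lo / lam)) := by positivity
  have hb : MemLp (FunctionSpaces.Torus.stLift (cellField W M hM ν hν.1 n)) ∞ (volume.restrict (Ioo 0 T ×ˢ (univ : Set (EuclideanSpace ℝ (Fin 3))))) := by
    unfold cellField
    exact memLp_top_stLift_cell _ n T
  have hMb : 0 ≤ (k:ℝ) / (2 * Real.pi * n) := by positivity
  have hbM : ∀ᵐ s ∂(volume.restrict (Ioo 0 T)), ∀ᵐ x ∂volume, ‖cellField W M hM ν hν.1 n s x‖ ≤ (k:ℝ) / (2 * Real.pi * n) :=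
    ae_of_all _ fun s => ae_of_all _ fun x => by unfold cellField; exact norm_cell_le_div _ hn s x
  have hper : ∀ (j : Fin 3 → Fin n) t x, cellField W M hM ν hν.1 n t (x + fun i => ((((j i : ℕ) : ℝ) / n : ℝ) : UnitAddCircle)) =
      cellField W M hM ν hν.1 n t x := fun j t x => by unfold cellField; exact cell_add_grid _ hn j t x
  -- Fourier support of the datum: `{ℓ, −ℓ}`, inside the sector
  set S : Finset (Fin 3 → ℤ) := {ℓ, -ℓ} with hS_def
  have hS : ∀ k' ∈ S, -k' ∈ S := by
    intro k' hk'
    rcases Finset.mem_insert.1 hk' with rfl | hk'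
    · exact Finset.mem_insert_of_mem (Finset.mem_singleton_self _)
    · rw [Finset.mem_singleton.1 hk', neg_neg]; exact Finset.mem_insert_self _ _
  have hnotS : ∀ k', k' ∉ S → k' ≠ ℓ ∧ k' ≠ -ℓ := fun k' hk' =>
    ⟨fun h => hk' (h ▸ Finset.mem_insert_self _ _), fun h => hk' (h ▸ Finset.mem_insert_of_mem (Finset.mem_singleton_self _))⟩
  have hsupp₀ : ∀ k', k' ∉ S → mFourierCoeff (FunctionSpaces.EuclideanSpace.complexify ∘ w₀) k' = 0 := fun k' hk' =>
    mFourierCoeff_singleMode_eq_zero ℓ p (hnotS k' hk').1 (hnotS k' hk').2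
  have hsuppSec : ∀ k', mFourierCoeff (FunctionSpaces.EuclideanSpace.complexify ∘ w₀) k' ≠ 0 →
      (∀ i, (n : ℤ) ∣ k' i - ℓ i) ∨ (∀ i, (n : ℤ) ∣ k' i + ℓ i) := by
    intro k' hk'
    by_cases h1 : k' = ℓ
    · exact Or.inl fun i => by rw [h1, sub_self]; exact dvd_zero _
    by_cases h2 : k' = -ℓ
    · exact Or.inr fun i => by rw [h2, Pi.neg_apply, neg_add_cancel]; exact dvd_zero _
    exact absurd (mFourierCoeff_singleMode_eq_zero ℓ p h1 h2) hk'
  -- sector preservation ⇒ spectral separation of the complement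
  have hsec := hw.ae_mFourierCoeff_eq_zero_off_sector hn ℓ hN hlo' hb hper hw₀2 hsuppSec
  have hgap : ∀ᵐ s ∂(volume.restrict (Ioo 0 T)), ∀ k', k' ∉ S →
      mFourierCoeff (FunctionSpaces.EuclideanSpace.complexify ∘ w s) k' ≠ 0 → (n:ℝ) ^ 2 / 4 ≤ FunctionSpaces.Torus.freqNormSq k' := by
    filter_upwards [hsec] with s hs
    intro k' hk' hne
    have hin : (∀ i, (n : ℤ) ∣ k' i - ℓ i) ∨ (∀ i, (n : ℤ) ∣ k' i + ℓ i) := by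
      by_contra hc
      exact hne (hs k' hc)
    exact freqNormSq_ge_of_sector hℓi hin (hnotS k' hk').1 (hnotS k' hk').2
  -- the block dissipation bound `Γ² = 4π² ‖ℓ‖² E₀`
  obtain ⟨E₀, hE₀⟩ : ∃ E₀ : ℝ, E₀ = ∫ x, ‖w₀ x‖ ^ 2 := ⟨_, rfl⟩
  have hE₀nn : 0 ≤ E₀ := by rw [hE₀]; exact integral_nonneg fun x => sq_nonneg _
  have hE₀goal : ∫ x, ‖(UnitAddTorus.mFourier ℓ x).re • p‖ ^ 2 = E₀ := by rw [hE₀]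
  rw [hE₀goal]
  obtain ⟨Γ, hΓ⟩ : ∃ Γ : ℝ, Γ = 2 * Real.pi * ‖Torus.latticeVec ℓ‖ * Real.sqrt E₀ := ⟨_, rfl⟩
  have hΓ0 : 0 ≤ Γ := by
    rw [hΓ]
    exact mul_nonneg (mul_nonneg (mul_nonneg (by norm_num) Real.pi_pos.le) (norm_nonneg _)) (Real.sqrt_nonneg _)
  have hΓsq : Γ ^ 2 = 4 * Real.pi ^ 2 * FunctionSpaces.Torus.freqNormSq ℓ * E₀ := by
    rw [hΓ, ← norm_latticeVec_sq', mul_pow, mul_pow, mul_pow, Real.sq_sqrt hE₀nn]; ring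
  have hEle : ∀ᵐ s ∂(volume.restrict (Ioo 0 T)), ∫ x, ‖w s x‖ ^ 2 ≤ E₀ := by
    filter_upwards [hw.ae_energy_ineq hN hlo' hw₀2 hdiv₀ hb] with s hs
    have h1 : ENNReal.ofReal (∫ x, ‖w s x‖ ^ 2) ≤ ENNReal.ofReal E₀ := by rw [hE₀]; exact le_trans le_self_add hs
    exact (ENNReal.ofReal_le_ofReal_iff hE₀nn).1 h1
  have hslow : ∀ᵐ s ∂(volume.restrict (Ioo 0 T)), 4 * Real.pi ^ 2 * ∑ k' ∈ S, FunctionSpaces.Torus.freqNormSq k' *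
      ‖mFourierCoeff (FunctionSpaces.EuclideanSpace.complexify ∘ w s) k'‖ ^ 2 ≤ Γ ^ 2 := by
    filter_upwards [hEle, hw.ae_memLp_two] with s hs hs2
    have hpars := Torus.integral_norm_sq_sub_realTrigPoly_coeff hS hs2
    have hsum : ∑ k' ∈ S, ‖mFourierCoeff (FunctionSpaces.EuclideanSpace.complexify ∘ w s) k'‖ ^ 2 ≤ E₀ := by
      have h0 : 0 ≤ ∫ x, ‖w s x - FunctionSpaces.Torus.realTrigPoly S
          (fun k' => mFourierCoeff (FunctionSpaces.EuclideanSpace.complexify ∘ w s) k') x‖ ^ 2 :=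
        integral_nonneg fun x => sq_nonneg _
      linarith
    have hfreq : ∀ k' ∈ S, FunctionSpaces.Torus.freqNormSq k' = FunctionSpaces.Torus.freqNormSq ℓ := by
      intro k' hk'
      rcases Finset.mem_insert.1 hk' with rfl | hk'
      · rfl
      · rw [Finset.mem_singleton.1 hk', FunctionSpaces.Torus.freqNormSq_neg]
    rw [Finset.sum_congr rfl fun k' hk' => by rw [hfreq k' hk'], ← Finset.mul_sum, hΓsq]
    have := FunctionSpaces.Torus.freqNormSq_nonneg ℓ
    have h2 := mul_le_mul_of_nonneg_left (mul_le_mul_of_nonneg_left hsum this) (by positivity : (0:ℝ) ≤ 4 * Real.pi ^ 2)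
    linarith
  -- the fast-block bound
  have hmain := hw.ae_complement_energy_le hN hlo' hw₀2 hdiv₀ hb hMb hbM S hS hsupp₀ (by positivity : (0:ℝ) < (n:ℝ) ^ 2 / 4)
    hgap hΓ0 hslow
  -- conclude
  filter_upwards [hmain, hw.ae_memLp_two] with t ht ht2
  have hwi : Integrable (w t) volume := ht2.integrable one_le_two
  -- the clause integrates the constant `lowEnergy` over the (probability) torus
  have hsplit : ∫ x, (‖w t x‖ ^ 2 - lowEnergy ((n:ℝ) / 2) (w t)) = (∫ x, ‖w t x‖ ^ 2) - lowEnergy ((n:ℝ) / 2) (w t) := by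
    rw [integral_sub (ht2.integrable_norm_pow two_ne_zero) (integrable_const _), integral_const, smul_eq_mul]
    simp
  rw [hsplit]
  have hne : ℓ ≠ -ℓ := by
    intro h; apply hℓ; funext i
    have hi := congrArg (fun v => v i) h
    simp only [Pi.neg_apply] at hi
    have : ℓ i = 0 := by omega
    simpa using this
  have hlow : ∑ k' ∈ S, ‖mFourierCoeff (FunctionSpaces.EuclideanSpace.complexify ∘ w t) k'‖ ^ 2 ≤ lowEnergy ((n:ℝ) / 2) (w t) := by
    rw [hS_def, Finset.sum_pair hne, ← sectorEnergy_eq hwi, ← sectorEnergy_eq hwi]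
    exact pair_le_lowEnergy hℓ hℓL (w t)
  have hB : (∫ x, ‖w t x‖ ^ 2) - lowEnergy ((n:ℝ) / 2) (w t) ≤
      (Fintype.card (Fin 3) * ((k:ℝ) / (2 * Real.pi * n)) * Γ) ^ 2 /
        (4 * Real.pi ^ 2 * ((1 / (n:ℝ) ^ 2) * (ν * (lo / lam))) * ((n:ℝ) ^ 2 / 4)) ^ 2 := by linarith
  refine hB.trans ?_
  -- arithmetic: the bound equals `9k²lam²‖ℓ‖²E₀/(π⁴n²ν²lo²) ≤ C·(c‖ℓ‖²/(n²ν²))·E₀`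
  have hnR : (0:ℝ) < n := by exact_mod_cast hn
  have hden : 4 * Real.pi ^ 2 * ((1 / (n:ℝ) ^ 2) * (ν * (lo / lam))) * ((n:ℝ) ^ 2 / 4) = Real.pi ^ 2 * ν * lo / lam := by
    field_simp
  rw [hden, Fintype.card_fin]
  have hnum : ((3:ℕ) * ((k:ℝ) / (2 * Real.pi * n)) * Γ) ^ 2 =
      9 * (k:ℝ) ^ 2 * FunctionSpaces.Torus.freqNormSq ℓ * E₀ / (n:ℝ) ^ 2 := by
    rw [mul_pow, mul_pow, hΓsq]
    field_simp
    ring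
  rw [show ((Fintype.card (Fin 3) : ℕ) : ℝ) = ((3 : ℕ) : ℝ) by rw [Fintype.card_fin]] at *
  rw [hnum, ← norm_latticeVec_sq']
  have hℓ2 : 0 ≤ ‖Torus.latticeVec ℓ‖ ^ 2 := sq_nonneg _
  have hlamΛ : lam ^ 2 ≤ Λ ^ 2 := pow_le_pow_left₀ hlam1.le hlam.2 2
  have hπ := Real.pi_pos
  -- both sides as explicit fractions
  rw [div_le_iff₀ (by positivity)]
  have e1 : 9 * (k:ℝ) ^ 2 * Λ ^ 2 / (Real.pi ^ 4 * lo ^ 2 * c) * (c * ‖Torus.latticeVec ℓ‖ ^ 2 / ((n:ℝ) ^ 2 * ν ^ 2)) * E₀ *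
      (Real.pi ^ 2 * ν * lo / lam) ^ 2 = 9 * (k:ℝ) ^ 2 * ‖Torus.latticeVec ℓ‖ ^ 2 * E₀ / (n:ℝ) ^ 2 * (Λ ^ 2 / lam ^ 2) := by
    field_simp
  rw [e1]
  have hbase : 0 ≤ 9 * (k:ℝ) ^ 2 * ‖Torus.latticeVec ℓ‖ ^ 2 * E₀ / (n:ℝ) ^ 2 := by positivity
  have hrat : 1 ≤ Λ ^ 2 / lam ^ 2 := by rw [le_div_iff₀ (by positivity)]; linarith
  nlinarith

end Summit.AnomalousDissipation.AnomalousDissipation.Theorems.SolenoidalFractalHomogenisation.LagrangianStep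

end

/-! ## Amendment 1 (lead-k1l-onelevel-p1 g0, 2026-08-28): sector preservation of the cell problem, stated on its own -/

noncomputable section

namespace Summit.AnomalousDissipation.AnomalousDissipation.Theorems.SolenoidalFractalHomogenisation.LagrangianStep

open Literature.Analysis Literature.Analysis.FluidPDE Literature.Analysis.FunctionSpaces
open Literature.Analysis.FluidPDE.LatticeShear
open MeasureTheory Set Filter Function UnitAddTorus
open scoped ENNReal NNReal InnerProductSpace
open Summit.AnomalousDissipation.AnomalousDissipation.Theorems.SolenoidalFractalHomogenisation.RealisedQuasiStaticCellLaw

/-- **Bloch-sector preservation for the tensor cell problem.**  For `n ≥ 1`, a cell viscosity `ν > 0`, a constant tensor `𝔸` with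
`NearIso 𝔸 (ν lo/λ) (ν hi λ)` (`lo, λ > 0`), a mode `ℓ` and any polarisation `p` (no transversality needed here): every weak solution of the cell problem (tensor
`(1/n²)•𝔸`, carrier `cellField W M hM ν _ n`) from `Re e_ℓ·p` has, for a.e. `t ∈ (0,T)`, Fourier coefficients vanishing off the
symmetric sector `{k : n ∣ kᵢ − ℓᵢ ∀ i} ∪ {k : n ∣ kᵢ + ℓᵢ ∀ i}` (`PassiveVectorTensorSymmetry.ae_mFourierCoeff_eq_zero_off_sector`
along the grid-invariant cell carrier). [cite: KhaKuchment2021, §1.1–§1.2 (G-periodic operators, Floquet transform)] -/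
theorem cell_sector_preservation {k : ℕ} (W : LatticeWord k) (M : ℝ) (hM : 0 < M) {lo hi lam ν : ℝ} (hlo : 0 < lo)
    (hlam : 0 < lam) (hν : 0 < ν) {n : ℕ} (hn : 0 < n) {𝔸 : Torus.Visc4 (Fin 3)}
    (hA : Torus.NearIso 𝔸 (ν * (lo / lam)) (ν * (hi * lam))) (ℓ : Fin 3 → ℤ) (p : EuclideanSpace ℝ (Fin 3))
    {T : ℝ} {w : ℝ → VF}
    (hw : Torus.IsWeakTensorPassiveVectorOn 0 T ((1 / (n:ℝ) ^ 2) • 𝔸) (cellField W M hM ν hν n)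
      (fun x => (UnitAddTorus.mFourier ℓ x).re • p) w) :
    ∀ᵐ t ∂(volume.restrict (Ioo 0 T)), ∀ k', ¬ ((∀ i, (n : ℤ) ∣ k' i - ℓ i) ∨ (∀ i, (n : ℤ) ∣ k' i + ℓ i)) →
      mFourierCoeff (FunctionSpaces.EuclideanSpace.complexify ∘ w t) k' = 0 := by
  have hN : Torus.NearIso ((1 / (n:ℝ) ^ 2) • 𝔸) ((1 / (n:ℝ) ^ 2) * (ν * (lo / lam))) ((1 / (n:ℝ) ^ 2) * (ν * (hi * lam))) :=
    hA.smul (by positivity)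
  have hn' : (0:ℝ) < n := by exact_mod_cast hn
  have hlo' : 0 < (1 / (n:ℝ) ^ 2) * (ν * (lo / lam)) := by positivity
  have hb : MemLp (FunctionSpaces.Torus.stLift (cellField W M hM ν hν n)) ∞
      (volume.restrict (Ioo 0 T ×ˢ (univ : Set (EuclideanSpace ℝ (Fin 3))))) := by
    unfold cellField
    exact memLp_top_stLift_cell _ n T
  have hper : ∀ (j : Fin 3 → Fin n) t x, cellField W M hM ν hν n t (x + fun i => ((((j i : ℕ) : ℝ) / n : ℝ) : UnitAddCircle)) =
      cellField W M hM ν hν n t x := fun j t x => by unfold cellField; exact cell_add_grid _ hn j t x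
  have hw₀2 : MemLp (fun x : UnitAddTorus (Fin 3) => (UnitAddTorus.mFourier ℓ x).re • p) 2 volume :=
    memLp_two_of_memSobolev_one_complexify (memSobolev_one_singleMode ℓ p)
  have hsuppSec : ∀ k', mFourierCoeff (FunctionSpaces.EuclideanSpace.complexify ∘
      fun x : UnitAddTorus (Fin 3) => (UnitAddTorus.mFourier ℓ x).re • p) k' ≠ 0 →
      (∀ i, (n : ℤ) ∣ k' i - ℓ i) ∨ (∀ i, (n : ℤ) ∣ k' i + ℓ i) := by
    intro k' hk'
    by_cases h1 : k' = ℓ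
    · exact Or.inl fun i => by rw [h1, sub_self]; exact dvd_zero _
    by_cases h2 : k' = -ℓ
    · exact Or.inr fun i => by rw [h2, Pi.neg_apply, neg_add_cancel]; exact dvd_zero _
    exact absurd (mFourierCoeff_singleMode_eq_zero ℓ p h1 h2) hk'
  exact hw.ae_mFourierCoeff_eq_zero_off_sector hn ℓ hN hlo' hb hper hw₀2 hsuppSec

end Summit.AnomalousDissipation.AnomalousDissipation.Theorems.SolenoidalFractalHomogenisation.LagrangianStep

end
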